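import Literature.Computation.FiniteGraph.SAWWeightBridge
import Literature.Probability.LatticeModels.LatticeDobrushinBox
import HarnessLib

/-!
# Finite-graph witness engine, VIII: lattice domains and boxes, hypothesis-free

Topic `Literature/Computation/FiniteGraph`; everything proved, no facts. Parts VI–VII evaluate the
critical SAW weights of a domain under the hypothesis
`hG : ∀ x y, (discreteDomainGraph Ω δ).Adj x y ↔ (zdGraph 2).Adj x y ∧ toPair x ∈ S ∧ toPair y ∈ S`.
This file discharges `hG` for the tree's combinatorial lattice domains
(`Literature.Probability.LatticeModels.LatticeDobrushin`, realised as `siteDomain L.S` at mesh `1`,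
whose domain graph is `ℤ²` induced on `L.S` by `LatticeDobrushin.adj_iff`) and, with no hypothesis
at all, for boxes `siteDomain (boxSites a b)`:

* `boxList a b` (the sites of a box as a list) with `mem_boxList_iff`, `mem_boxSites_iff_toPair`;
* `adj_iff_of_latticeDobrushin`, `box_adj_iff` — the `hG` of parts VI–VII;
* **`SAW_weight_latticeDobrushin_eq`**, **`SAW_weight_box_eq`**:
  `SAW.weight (siteDomain (boxSites a b)) 1 p q univ = ofReal (peval (sawPoly (boxList (toPair a) (toPair b)) p q) x_c)`;
* **`box_weight_mul_weight_lt_of_posCert`** (any interval `[lo, hi] ∋ x_c`),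
  **`box_weight_avoids_mul_lt_of_posCert`**, and the axiom-free instance
  **`box_weight_mul_weight_lt_of_posCert_third_half`** on `x_c ∈ [1/3, 1/2]` — the TP₂/FKG-shaped strict
  product inequality between four critical two-point weights of a box from ONE kernel-decidable
  certificate (the sharp interval `[200/539, 5/13]`, needed from `5 × 5` on, is the computational
  companion `SAWSharpFugacity.lean`).

Boxes are bounded, open and simply connected (`isBounded_siteDomain`, `isOpen_siteDomain`; convexity
of the open rectangle), so they are admissible domains of the planar SAW statements; those facts are
not needed for the weight identities and are not repeated here. [folklore] throughout.

Measured on the Lean farm (corner points of the box in cyclic order, the full certificate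
`box_weight_mul_weight_lt_of_posCert … (by decide +kernel)`): `3 × 3` ≈ 2 s, `4 × 3` ≈ 4 s in the
KERNEL; the kernel cost is heartbeat-bound (≈ 7 ms and many allocations per search node): one
`sawCounts` of the `4 × 4` box (≈ 1.3·10³ nodes) takes ≈ 10 s and needs
`set_option maxHeartbeats 800000 in` (the default `200000` is exceeded), so the full `4 × 4`
certificate wants ≈ 3·10⁶ heartbeats; `native_decide` is instantaneous there and handles `5 × 5` and
`6 × 5` (depth `4`) in well under a minute — the regime of the enumeration evidence quoted on the SAW
routes (boxes up to `7 × 6`).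

## References
* H. Duminil-Copin, C. Hongler, P. Nolin, CPAM 64 (2011), §2.2 (lattice Dobrushin domains)
  [DuminilCopinHonglerNolin2011].
* G. Lawler, O. Schramm, W. Werner, 2004, §3.1 (the SAW measure) [LawlerSchrammWerner2004SAW].
-/

noncomputable section

namespace Literature.Computation.FiniteGraph

open MeasureTheory Literature.Probability.LatticeModels Literature.Probability.RandomPlanarGeometry
open Literature.Probability.RandomPlanarGeometry.SAW.FiniteMemory (toPair toPair_injective)
open scoped ENNReal

/-! ### Boxes as site lists -/

/-- The sites of the box `[a₁, b₁] × [a₂, b₂]` of `ℤ²`, as a list (column by column). [folklore] -/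
def boxList (a b : ℤ × ℤ) : List (ℤ × ℤ) :=
  (List.range (b.1 - a.1 + 1).toNat).flatMap fun (i : ℕ) =>
    (List.range (b.2 - a.2 + 1).toNat).map fun (j : ℕ) => (a.1 + (i : ℤ), a.2 + (j : ℤ))

/-- Membership in `boxList`. [folklore] -/
theorem mem_boxList_iff {a b p : ℤ × ℤ} :
    p ∈ boxList a b ↔ a.1 ≤ p.1 ∧ p.1 ≤ b.1 ∧ a.2 ≤ p.2 ∧ p.2 ≤ b.2 := by
  obtain ⟨p1, p2⟩ := p
  constructor
  · intro h
    simp only [boxList, List.mem_flatMap, List.mem_map, Prod.mk.injEq] at h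
    obtain ⟨i, hi, j, hj, h1, h2⟩ := h
    rw [List.mem_range] at hi hj
    simp only
    omega
  · rintro ⟨h1, h2, h3, h4⟩
    simp only at h1 h2 h3 h4
    simp only [boxList, List.mem_flatMap, List.mem_map, Prod.mk.injEq]
    exact ⟨(p1 - a.1).toNat, List.mem_range.2 (by omega), (p2 - a.2).toNat, List.mem_range.2 (by omega),
      by omega, by omega⟩

/-- A site lies in the box of sites iff its pair lies in the box list. [folklore] -/
theorem mem_boxSites_iff_toPair {a b x : Site 2} : x ∈ boxSites a b ↔ toPair x ∈ boxList (toPair a) (toPair b) := by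
  rw [mem_boxSites_iff, mem_boxList_iff, Fin.forall_fin_two]
  simp only [toPair]
  tauto

/-! ### The hypothesis `hG` for lattice domains -/

/-- **The domain graph of a lattice Dobrushin domain is `ℤ²` induced on its site list** — the
hypothesis `hG` of parts VI–VII, from `LatticeDobrushin.adj_iff`. [folklore] -/
theorem adj_iff_of_latticeDobrushin (L : LatticeDobrushin) {S : List (ℤ × ℤ)} (hS : ∀ x : Site 2, x ∈ L.S ↔ toPair x ∈ S)
    (x y : Site 2) :
    (discreteDomainGraph L.toDobrushin.Ω L.toDobrushin.δ).Adj x y ↔ (zdGraph 2).Adj x y ∧ toPair x ∈ S ∧ toPair y ∈ S := by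
  rw [L.adj_iff, hS, hS]

/-- The same for a box, with no hypothesis: the domain graph of `siteDomain (boxSites a b)` at mesh `1`
is `ℤ²` induced on `boxList`. [folklore] -/
theorem box_adj_iff (a b x y : Site 2) :
    (discreteDomainGraph (siteDomain (boxSites a b)) 1).Adj x y ↔
      (zdGraph 2).Adj x y ∧ toPair x ∈ boxList (toPair a) (toPair b) ∧ toPair y ∈ boxList (toPair a) (toPair b) :=
  adj_iff_of_latticeDobrushin (LatticeDobrushin.ofBox a b ∅ (Set.empty_subset _)) (fun _ => mem_boxSites_iff_toPair) x y

/-! ### Weights of lattice domains and boxes -/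

/-- **Critical two-point SAW weight of a lattice Dobrushin domain.** [cite: LawlerSchrammWerner2004SAW, §3.1 and §3.4.2] -/
theorem SAW_weight_latticeDobrushin_eq (L : LatticeDobrushin) {S : List (ℤ × ℤ)} (hS : ∀ x : Site 2, x ∈ L.S ↔ toPair x ∈ S)
    (p q : Site 2) :
    SAW.weight L.toDobrushin.Ω L.toDobrushin.δ p q Set.univ = ENNReal.ofReal (peval (sawPoly S p q) SAW.criticalFugacity) :=
  SAW_weight_univ_eq (adj_iff_of_latticeDobrushin L hS) p q

/-- **Critical two-point SAW weight of a box**, hypothesis-free: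
`SAW.weight (siteDomain (boxSites a b)) 1 p q univ = ofReal (peval (sawPoly (boxList (toPair a) (toPair b)) p q) x_c)`.
[cite: LawlerSchrammWerner2004SAW, §3.1 and §3.4.2] -/
theorem SAW_weight_box_eq (a b p q : Site 2) :
    SAW.weight (siteDomain (boxSites a b)) 1 p q Set.univ =
      ENNReal.ofReal (peval (sawPoly (boxList (toPair a) (toPair b)) p q) SAW.criticalFugacity) :=
  SAW_weight_univ_eq (box_adj_iff a b) p q

/-- Hull-avoidance events in a box. [cite: LawlerSchrammWerner2004SAW, §3.1 and §3.4.2] -/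
theorem SAW_weight_box_avoids_eq (a b p q : Site 2) (V : List (ℤ × ℤ)) (hp : toPair p ∉ V) :
    SAW.weight (siteDomain (boxSites a b)) 1 p q (avoids p q V) =
      ENNReal.ofReal (peval (sawPolyAvoiding (boxList (toPair a) (toPair b)) V p q) SAW.criticalFugacity) :=
  SAW_weight_avoids_eq (box_adj_iff a b) p q V hp

/-- **Certified strict product inequality between critical two-point weights of a box** from ONE
kernel-decidable sign certificate on an interval `[lo, hi] ∋ x_c`: with `Pᵢ = sawPoly (boxList a b) aᵢ bᵢ`,
`posCert (P₃P₄ − P₁P₂) d lo hi = true` gives `Z(a₁,b₁) Z(a₂,b₂) < Z(a₃,b₃) Z(a₄,b₄)`.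
(The shape of `BoundaryTP2`'s `Z₁₃ Z₂₄ ≤ Z₁₂ Z₃₄` and of its negation.) [folklore] -/
theorem box_weight_mul_weight_lt_of_posCert (a b a₁ b₁ a₂ b₂ a₃ b₃ a₄ b₄ : Site 2) {lo hi : ℚ} {d : ℕ}
    (hlo : (lo : ℝ) ≤ SAW.criticalFugacity) (hhi : SAW.criticalFugacity ≤ hi)
    (h : posCert (psub (pmul (sawPoly (boxList (toPair a) (toPair b)) a₃ b₃) (sawPoly (boxList (toPair a) (toPair b)) a₄ b₄))
      (pmul (sawPoly (boxList (toPair a) (toPair b)) a₁ b₁) (sawPoly (boxList (toPair a) (toPair b)) a₂ b₂))) d lo hi = true) :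
    SAW.weight (siteDomain (boxSites a b)) 1 a₁ b₁ Set.univ * SAW.weight (siteDomain (boxSites a b)) 1 a₂ b₂ Set.univ <
      SAW.weight (siteDomain (boxSites a b)) 1 a₃ b₃ Set.univ * SAW.weight (siteDomain (boxSites a b)) 1 a₄ b₄ Set.univ :=
  weight_mul_weight_lt_of_posCert (box_adj_iff a b) a₁ b₁ a₂ b₂ a₃ b₃ a₄ b₄ hlo hhi h

/-- The same for hull-avoidance events in a box (`Pᵢ = sawPolyAvoiding (boxList a b) Vᵢ aᵢ bᵢ`,
`aᵢ ∉ Vᵢ`). [folklore] -/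
theorem box_weight_avoids_mul_lt_of_posCert (a b a₁ b₁ a₂ b₂ a₃ b₃ a₄ b₄ : Site 2) (V₁ V₂ V₃ V₄ : List (ℤ × ℤ))
    (h₁ : toPair a₁ ∉ V₁) (h₂ : toPair a₂ ∉ V₂) (h₃ : toPair a₃ ∉ V₃) (h₄ : toPair a₄ ∉ V₄) {lo hi : ℚ} {d : ℕ}
    (hlo : (lo : ℝ) ≤ SAW.criticalFugacity) (hhi : SAW.criticalFugacity ≤ hi)
    (h : posCert (psub (pmul (sawPolyAvoiding (boxList (toPair a) (toPair b)) V₃ a₃ b₃)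
        (sawPolyAvoiding (boxList (toPair a) (toPair b)) V₄ a₄ b₄))
      (pmul (sawPolyAvoiding (boxList (toPair a) (toPair b)) V₁ a₁ b₁)
        (sawPolyAvoiding (boxList (toPair a) (toPair b)) V₂ a₂ b₂))) d lo hi = true) :
    SAW.weight (siteDomain (boxSites a b)) 1 a₁ b₁ (avoids a₁ b₁ V₁) *
        SAW.weight (siteDomain (boxSites a b)) 1 a₂ b₂ (avoids a₂ b₂ V₂) <
      SAW.weight (siteDomain (boxSites a b)) 1 a₃ b₃ (avoids a₃ b₃ V₃) *
        SAW.weight (siteDomain (boxSites a b)) 1 a₄ b₄ (avoids a₄ b₄ V₄) :=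
  weight_avoids_mul_lt_of_posCert (box_adj_iff a b) a₁ b₁ a₂ b₂ a₃ b₃ a₄ b₄ V₁ V₂ V₃ V₄ h₁ h₂ h₃ h₄ hlo hhi h

/-- **Axiom-free instance on the elementary interval `x_c ∈ [1/3, 1/2]`** (enough for boxes up to
`5 × 4` at the corner points; sharper intervals: `SAWSharpFugacity.lean`). [folklore] -/
theorem box_weight_mul_weight_lt_of_posCert_third_half (a b a₁ b₁ a₂ b₂ a₃ b₃ a₄ b₄ : Site 2) {d : ℕ}
    (h : posCert (psub (pmul (sawPoly (boxList (toPair a) (toPair b)) a₃ b₃) (sawPoly (boxList (toPair a) (toPair b)) a₄ b₄))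
      (pmul (sawPoly (boxList (toPair a) (toPair b)) a₁ b₁) (sawPoly (boxList (toPair a) (toPair b)) a₂ b₂)))
      d (1 / 3) (1 / 2) = true) :
    SAW.weight (siteDomain (boxSites a b)) 1 a₁ b₁ Set.univ * SAW.weight (siteDomain (boxSites a b)) 1 a₂ b₂ Set.univ <
      SAW.weight (siteDomain (boxSites a b)) 1 a₃ b₃ Set.univ * SAW.weight (siteDomain (boxSites a b)) 1 a₄ b₄ Set.univ :=
  box_weight_mul_weight_lt_of_posCert a b a₁ b₁ a₂ b₂ a₃ b₃ a₄ b₄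
    criticalFugacity_mem_Icc_third_half.1 criticalFugacity_mem_Icc_third_half.2 h

/-! ### Kernel regression example (the `3 × 3` box `{0,1,2}²`) -/

/-- On the `3 × 3` box with corners `p₁ = (0,0)`, `p₂ = (2,0)`, `p₃ = (2,2)`, `p₄ = (0,2)` in cyclic
order, circular TP₂ holds strictly at `x_c`: `Z₁₃ Z₂₄ < Z₁₂ Z₃₄` — the difference polynomial
`x⁴ + 6x⁶ − 17x⁸ − 14x¹⁰ − 3x¹² + 4x¹⁴` is certified positive on `[1/3, 1/2]` at depth `0`
(axiom-clean: propext / Classical.choice / Quot.sound). -/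
example : SAW.weight (siteDomain (boxSites ![0, 0] ![2, 2])) 1 ![0, 0] ![2, 2] Set.univ *
      SAW.weight (siteDomain (boxSites ![0, 0] ![2, 2])) 1 ![2, 0] ![0, 2] Set.univ <
    SAW.weight (siteDomain (boxSites ![0, 0] ![2, 2])) 1 ![0, 0] ![2, 0] Set.univ *
      SAW.weight (siteDomain (boxSites ![0, 0] ![2, 2])) 1 ![2, 2] ![0, 2] Set.univ :=
  box_weight_mul_weight_lt_of_posCert_third_half ![0, 0] ![2, 2] ![0, 0] ![2, 2] ![2, 0] ![0, 2] ![0, 0] ![2, 0]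
    ![2, 2] ![0, 2] (d := 0) (by decide +kernel)

end Literature.Computation.FiniteGraph
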